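import Summits.Schanuel.Schanuel.Theorems.RootDecomp1KGeneric01

/-!
# RootDecomp1K — «GENERIC CELLS», part 2 of 3 (lens 6 «barrier-complement carving», gen 13 = 1K ROUND 9; §§3–6)

Continuation of `RootDecomp1KGeneric01` (pieces `KummerSpecialisation`, `CylinderFunnel(Weak)`, predicates
`HyperPairApprox(Poly)` and the PROVED piece NW: `not_hyperPairApprox_of_NW1996Thm1`).  This part: §3 the generic
triple `hyperTriple` (mod NW96 Thm 1 + KS + CF, for EVERY `u ≠ 0`), §4 the line cells `hyperCell_any` /
`hyperLiouvilleSchanuel_live_at_anyLineCell`, §5 the exact level-3 residual `Rank3HyperResidual` (`level3_iff_rank3`),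
the storey `HyperStoreyFrom4`, the assembly `hyperLiouvilleSchanuel_live_of_pieces` of the live item
`RootDecomp1K.HyperLiouvilleSchanuel` (stmt-Schanuel-33363) and the wall lemma `not_technicalHypothesis_of_hyperLinLiouville`
against the catalogued barrier `Literature.Barriers.Schanuel.LargeTranscendenceDegree`, §6 the CF rungs and the
hypothesis-free sharpness lemmas `cylinderFunnel_sharp` / `hyperTriple_sharp`.  Source: lens-6 g13 `GenericCells.lean`
(sha256 18523eb4…) ll. 332–695 verbatim.  Sorry-free; standard axioms; nothing here proves Schanuel (rung 0).
-/

noncomputable section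

open Complex IntermediateField Polynomial

namespace Summit.Schanuel.Schanuel.Theorems.RootDecomp1KGeneric

open Summit.Schanuel.Schanuel.Theorems.RootDecomp1KHyper (SB SFset sb_of_algebraicIndependent
  mem_adjoin_SFset_I')
open Summit.Schanuel.Schanuel.Theorems.RootDecomp1KHyper.HyperCell (HyperLiouville HyperLinLiouville
  pair_bounds HyperLiouville.ne_zero HyperLiouville.neg hyperLiouvilleSchanuel_live_of_three_le
  algebraicIndependent_kummer algebraicIndependent_torsion)
open Summit.Schanuel.Schanuel.Theorems.RootDecomp1KRadical (FiniteTranscendenceType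
  algebraicIndependent_radical)
open Literature.NumberTheory.Transcendental (NesterenkoWaldschmidt1996_thm_1 weilHeight₁)

/-! ## 3. The generic triple: `trdeg ℚ(u, e^u, ρ, e^{ρu}) ≥ 3` for EVERY `u ≠ 0` (mod NW + KS + CF) -/

/-- Transcendence over a polynomial ring `ℚ[t]` passes to the sub-ring `ℚ[s]`, `s ⊆ t`. -/
theorem transcendental_adjoin_mono {s t : Set ℂ} (hst : s ⊆ t) {x : ℂ}
    (hx : Transcendental (Algebra.adjoin ℚ t) x) : Transcendental (Algebra.adjoin ℚ s) x := by
  rintro ⟨p, hp0, hpx⟩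
  apply hx
  let ι : Algebra.adjoin ℚ s →ₐ[ℚ] Algebra.adjoin ℚ t := Subalgebra.inclusion (Algebra.adjoin_mono hst)
  refine ⟨p.map ι.toRingHom, ?_, ?_⟩
  · exact (Polynomial.map_ne_zero_iff (Subalgebra.inclusion_injective _)).mpr hp0
  · have hcomp : (algebraMap (Algebra.adjoin ℚ t) ℂ).comp ι.toRingHom =
        algebraMap (Algebra.adjoin ℚ s) ℂ := by
      ext a; rfl
    rw [Polynomial.aeval_def, Polynomial.eval₂_map, hcomp, ← Polynomial.aeval_def, hpx]

/-- **THE GENERIC TRIPLE (kernel, mod NW96 Thm 1 + KS + CF).**  For EVERY `u ≠ 0` and every hyper-Liouville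
`ρ > 0`, three of the four numbers `u, e^u, ρ, e^{ρu}` are algebraically independent — explicitly one of the triples
`(e^u, ρ, e^{ρu})`, `(u, ρ, e^u)`, `(u, ρ, e^{ρu})`.  No hypothesis on the anchor `u`. -/
theorem hyperTriple (hNW : NesterenkoWaldschmidt1996_thm_1) (hKS : KummerSpecialisation)
    (hCF : CylinderFunnelWeak) {u : ℂ} (hu0 : u ≠ 0) {ρ : ℝ} (hρ : HyperLiouville ρ) (hρ0 : 0 < ρ) :
    AlgebraicIndependent ℚ ![cexp u, (ρ : ℂ), cexp (u * ρ)] ∨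
    AlgebraicIndependent ℚ (fun o : Option (Fin 2) => o.elim u ![(ρ : ℂ), cexp u]) ∨
    AlgebraicIndependent ℚ (fun o : Option (Fin 2) => o.elim u ![(ρ : ℂ), cexp (u * ρ)]) := by
  by_cases hA3 : AlgebraicIndependent ℚ ![cexp u, (ρ : ℂ), cexp (u * ρ)]
  · exact Or.inl hA3
  by_cases hua : IsAlgebraic (Algebra.adjoin ℚ (Set.range ![cexp u, (ρ : ℂ), cexp (u * ρ)])) u
  · exact absurd (hKS u ρ hu0 hρ hρ0 hA3 hua) (not_hyperPairApprox_of_NW1996Thm1 hNW hu0)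
  have huT : Transcendental (Algebra.adjoin ℚ (Set.range ![cexp u, (ρ : ℂ), cexp (u * ρ)])) u := hua
  rcases hCF u ρ hu0 hρ hρ0 huT with h1 | h2
  · refine Or.inr (Or.inl ?_)
    rw [h1.option_iff_transcendental]
    refine transcendental_adjoin_mono ?_ huT
    rintro x ⟨i, rfl⟩
    fin_cases i
    · exact ⟨1, by simp⟩
    · exact ⟨0, by simp⟩
  · refine Or.inr (Or.inr ?_)
    rw [h2.option_iff_transcendental]
    refine transcendental_adjoin_mono ?_ huT
    rintro x ⟨i, rfl⟩
    fin_cases i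
    · exact ⟨1, by simp⟩
    · exact ⟨2, by simp⟩

/-! ## 4. The cells: EVERY line-cell of A₄ʰ at `n ≤ 3` has Schanuel's bound (mod NW + KS + CF) -/

/-- `SB N z` (`N ≤ 3`) as soon as the Schanuel field `ℚ(z, e^z, i)` contains `u ≠ 0`, `ρ'`, `e^u`, `e^{uρ'}`
for a hyper-Liouville `ρ' > 0`. -/
theorem sb_generic_of_mem (hNW : NesterenkoWaldschmidt1996_thm_1) (hKS : KummerSpecialisation)
    (hCF : CylinderFunnelWeak) {u : ℂ} (hu0 : u ≠ 0) {ρ' : ℝ} (hρ' : HyperLiouville ρ') (hρ'0 : 0 < ρ')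
    {N : ℕ} (hN : N ≤ 3) {z : Fin N → ℂ} (hu : u ∈ adjoin ℚ (SFset z ∪ {I}))
    (h0 : (ρ' : ℂ) ∈ adjoin ℚ (SFset z ∪ {I})) (h1 : cexp u ∈ adjoin ℚ (SFset z ∪ {I}))
    (h2 : cexp (u * (ρ' : ℂ)) ∈ adjoin ℚ (SFset z ∪ {I})) : SB N z := by
  rcases hyperTriple hNW hKS hCF hu0 hρ' hρ'0 with h | h | h
  · refine sb_of_algebraicIndependent h (by simpa using hN) fun j => ?_
    fin_cases j
    · exact h1
    · exact h0
    · exact h2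
  · refine sb_of_algebraicIndependent h (by simpa using hN) fun o => ?_
    rcases o with _ | j
    · exact hu
    · fin_cases j
      · exact h0
      · exact h1
  · refine sb_of_algebraicIndependent h (by simpa using hN) fun o => ?_
    rcases o with _ | j
    · exact hu
    · fin_cases j
      · exact h0
      · exact h2

/-- The same from the four natural generators `u, ρu, e^u, e^{ρu}` (`ρ` of either sign): the sign
normalisation `ρ' = ±ρ > 0`, `e^{uρ'} = (e^{ρu})^{±1}` of the radical cells. -/
theorem sb_generic_of_mem4 (hNW : NesterenkoWaldschmidt1996_thm_1) (hKS : KummerSpecialisation)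
    (hCF : CylinderFunnelWeak) {u : ℂ} (hu0 : u ≠ 0) {ρ : ℝ} (hρ : HyperLiouville ρ)
    {N : ℕ} (hN : N ≤ 3) {z : Fin N → ℂ} (hzu : u ∈ adjoin ℚ (SFset z ∪ {I}))
    (hzr : (ρ : ℂ) * u ∈ adjoin ℚ (SFset z ∪ {I})) (he1 : cexp ((ρ : ℂ) * u) ∈ adjoin ℚ (SFset z ∪ {I}))
    (he0 : cexp u ∈ adjoin ℚ (SFset z ∪ {I})) : SB N z := by
  have hρ0 : ρ ≠ 0 := HyperLiouville.ne_zero hρ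
  obtain ⟨ε, hε1, hpos⟩ : ∃ ε : ℝ, (ε = 1 ∨ ε = -1) ∧ 0 < ε * ρ := by
    rcases lt_or_gt_of_ne hρ0 with h | h
    · exact ⟨-1, Or.inr rfl, by nlinarith⟩
    · exact ⟨1, Or.inl rfl, by linarith⟩
  have hρ' : HyperLiouville (ε * ρ) := by
    rcases hε1 with rfl | rfl
    · rw [one_mul]; exact hρ
    · rw [neg_one_mul]; exact HyperLiouville.neg hρ
  set F := adjoin ℚ (SFset z ∪ {I}) with hF
  have hρmem : (ρ : ℂ) ∈ F := by
    have hdiv := div_mem hzr hzu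
    rwa [mul_div_assoc, div_self hu0, mul_one] at hdiv
  have h0 : (((ε * ρ : ℝ)) : ℂ) ∈ F := by
    rcases hε1 with rfl | rfl
    · push_cast; rw [one_mul]; exact hρmem
    · push_cast; rw [neg_one_mul]; exact neg_mem hρmem
  have h2 : cexp (u * (((ε * ρ : ℝ)) : ℂ)) ∈ F := by
    rcases hε1 with rfl | rfl
    · have e : cexp (u * (((1 * ρ : ℝ)) : ℂ)) = cexp ((ρ : ℂ) * u) := by
        congr 1; push_cast; ring
      rw [e]; exact he1
    · have e : cexp (u * (((-1 * ρ : ℝ)) : ℂ)) = (cexp ((ρ : ℂ) * u))⁻¹ := by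
        rw [← Complex.exp_neg]; congr 1; push_cast; ring
      rw [e]; exact inv_mem he1
  exact sb_generic_of_mem hNW hKS hCF hu0 hρ' hpos hN hzu h0 he0 h2

/-- **GENERIC CELLS (kernel, mod NW96 Thm 1 + KS + CF).**  For EVERY `u ≠ 0`, every hyper-Liouville `ρ` and
every `w`: `SB 2 (u, ρu)` and `SB 3 (u, ρu, w)` — the line-cells of A₄ʰ with NO hypothesis on the anchor. -/
theorem hyperCell_any (hNW : NesterenkoWaldschmidt1996_thm_1) (hKS : KummerSpecialisation)
    (hCF : CylinderFunnelWeak) {u : ℂ} (hu0 : u ≠ 0) {ρ : ℝ} (hρ : HyperLiouville ρ) (w : ℂ) :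
    SB 2 ![u, (ρ : ℂ) * u] ∧ SB 3 ![u, (ρ : ℂ) * u, w] := by
  refine ⟨?_, ?_⟩
  · exact sb_generic_of_mem4 hNW hKS hCF hu0 hρ (show 2 ≤ 3 by norm_num)
      (mem_adjoin_SFset_I' (Or.inl ⟨0, rfl⟩)) (mem_adjoin_SFset_I' (Or.inl ⟨1, rfl⟩))
      (mem_adjoin_SFset_I' (Or.inr ⟨1, rfl⟩)) (mem_adjoin_SFset_I' (Or.inr ⟨0, rfl⟩))
  · exact sb_generic_of_mem4 hNW hKS hCF hu0 hρ le_rfl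
      (mem_adjoin_SFset_I' (Or.inl ⟨0, rfl⟩)) (mem_adjoin_SFset_I' (Or.inl ⟨1, rfl⟩))
      (mem_adjoin_SFset_I' (Or.inr ⟨1, rfl⟩)) (mem_adjoin_SFset_I' (Or.inr ⟨0, rfl⟩))

/-- Live-text form (the body of A₄ʰ = `HyperLiouvilleSchanuel`, item 33363, at `n = 3`) at EVERY line-cell —
both hypotheses of A₄ʰ idle (mod NW96 Thm 1 + KS + CF). -/
theorem hyperLiouvilleSchanuel_live_at_anyLineCell (hNW : NesterenkoWaldschmidt1996_thm_1)
    (hKS : KummerSpecialisation) (hCF : CylinderFunnelWeak) {u : ℂ} (hu0 : u ≠ 0) {ρ : ℝ}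
    (hρ : HyperLiouville ρ) (w : ℂ) :
    LinearIndependent ℚ ![u, (ρ : ℂ) * u, w] →
    (∀ m : ℕ, ∃ h : Fin 3 → ℤ, h ≠ 0 ∧
      ‖∑ i, (h i : ℂ) * ![u, (ρ : ℂ) * u, w] i‖ < Real.exp (-((1 + ∑ i, (|h i| : ℝ)) ^ m))) →
    ((3 : ℕ) : Cardinal) ≤ Algebra.trdeg ℚ ↥(IntermediateField.adjoin ℚ
      (Set.range ![u, (ρ : ℂ) * u, w] ∪ Set.range (Complex.exp ∘ ![u, (ρ : ℂ) * u, w]))) :=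
  fun _ _ => (hyperCell_any hNW hKS hCF hu0 hρ w).2

/-! ## 5. The level-3 storey of A₄ʰ is EXACTLY the rank-3 residual (mod NW + KS + CF); assembly of the live item -/

/-- A tuple has a HYPER-LIOUVILLE RATIO: two coordinates proportional by a hyper-Liouville real. -/
def HasHLRatio {n : ℕ} (z : Fin n → ℂ) : Prop :=
  ∃ (i j : Fin n) (ρ : ℝ), HyperLiouville ρ ∧ z j = (ρ : ℂ) * z i

/-- **Coordinate-free form of the generic cells.**  A ℚ-free triple with a hyper-Liouville ratio has `SB 3`. -/
theorem sb_three_of_hlRatio (hNW : NesterenkoWaldschmidt1996_thm_1) (hKS : KummerSpecialisation)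
    (hCF : CylinderFunnelWeak) {z : Fin 3 → ℂ} (hz : LinearIndependent ℚ z) (hr : HasHLRatio z) : SB 3 z := by
  obtain ⟨i, j, ρ, hρ, hij⟩ := hr
  have hu0 : z i ≠ 0 := hz.ne_zero i
  refine sb_generic_of_mem4 hNW hKS hCF hu0 hρ le_rfl (mem_adjoin_SFset_I' (Or.inl ⟨i, rfl⟩)) ?_ ?_
    (mem_adjoin_SFset_I' (Or.inr ⟨i, rfl⟩))
  · rw [← hij]; exact mem_adjoin_SFset_I' (Or.inl ⟨j, rfl⟩)
  · rw [← hij]; exact mem_adjoin_SFset_I' (Or.inr ⟨j, rfl⟩)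

/-- **The RANK-3 RESIDUAL of A₄ʰ at level 3 (typed; UNDECIDED — BARRIER: needs a LEVEL-2 simultaneous measure).**
ℚ-free hyper-Liouville triples with NO hyper-Liouville coordinate ratio (genuinely ternary small forms
`h₀z₀ + h₁z₁ + h₂z₂`, e.g. `(1, x, y)` with `(x, y)` a Liouville vector) have Schanuel's bound.  The Kummer
specialisation still applies (`e^{z₂} ≈ (e^{z₀/h₂})^{−h₀}(e^{z₁/h₂})^{−h₁}`), but its output is a simultaneous
approximation of the QUADRUPLE `(z₀, z₁, e^{z₀}, e^{z₁})`, and no degree-uniform measure of such quadruples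
(quantitative two-variable Schanuel) is in print. -/
@[conjecture] def Rank3HyperResidual : Prop :=
  ∀ z : Fin 3 → ℂ, LinearIndependent ℚ z → HyperLinLiouville z → ¬ HasHLRatio z → SB 3 z

/-- The storey `n ≥ 4` of A₄ʰ (unchanged by this file). -/
@[conjecture] def HyperStoreyFrom4 : Prop :=
  ∀ (n : ℕ) (z : Fin n → ℂ), 4 ≤ n → LinearIndependent ℚ z → HyperLinLiouville z → SB n z

/-- **WHY the catalogued large-transcendence-degree methods stop at the residual (kernel,
hypothesis-free).**  Every hyper-Liouville point — in particular every point of `Rank3HyperResidual` and of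
`HyperStoreyFrom4` — VIOLATES the Technical Hypothesis (Nesterenko–Philippon 2001, Ch. 14, Def. 2.6:
`|h·z| ≥ exp(−H^ε)`) under which ALL printed criteria for algebraic independence deliver large
transcendence degree (`Literature.Barriers.Schanuel.LargeTranscendenceDegree` = Diaz 1989 / Philippon's
criterion, and Waldschmidt's Conjecture 2.3 programme).  So the residual lies INSIDE the walled region of
that catalogued barrier: a lever for it must work WITHOUT any measure of linear independence of `z`. -/
theorem not_technicalHypothesis_of_hyperLinLiouville {n : ℕ} {z : Fin n → ℂ}
    (hz : HyperLinLiouville z) : ¬ Literature.Barriers.Schanuel.TechnicalHypothesis z := by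
  intro hT
  obtain ⟨H₀, hH₀, hH⟩ := hT 1 one_pos
  obtain ⟨h, hh, hsmall⟩ := hz (⌈H₀⌉₊ + 1)
  set S : ℝ := 1 + ∑ i, (|h i| : ℝ) with hS
  have hsingle : ∀ i, |(h i : ℝ)| ≤ ∑ j, |(h j : ℝ)| := fun i =>
    Finset.single_le_sum (f := fun j => |(h j : ℝ)|) (fun j _ => abs_nonneg _) (Finset.mem_univ i)
  have hS2 : 2 ≤ S := by
    obtain ⟨i, hi⟩ : ∃ i, h i ≠ 0 := Function.ne_iff.mp hh
    have h1 : (1 : ℝ) ≤ |(h i : ℝ)| := by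
      rw [← Int.cast_abs]
      exact_mod_cast Int.one_le_abs hi
    linarith [hsingle i]
  set H : ℝ := max H₀ (S ^ (⌈H₀⌉₊ + 1)) with hHdef
  have hcoord : ∀ i, |(h i : ℝ)| ≤ H := by
    intro i
    have h2 : S ≤ S ^ (⌈H₀⌉₊ + 1) := le_self_pow₀ (by linarith) (by omega)
    calc |(h i : ℝ)| ≤ S := by linarith [hsingle i]
      _ ≤ H := h2.trans (le_max_right _ _)
  have hlow := hH H (le_max_left _ _) h hh hcoord
  rw [Real.rpow_one] at hlow
  have hpow : H ≤ S ^ (⌈H₀⌉₊ + 1) := by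
    refine max_le ?_ le_rfl
    have h2m : (2 : ℝ) ^ (⌈H₀⌉₊ + 1) ≤ S ^ (⌈H₀⌉₊ + 1) := pow_le_pow_left₀ (by norm_num) hS2 _
    have hnat : (⌈H₀⌉₊ + 1 : ℕ) < 2 ^ (⌈H₀⌉₊ + 1) := Nat.lt_two_pow_self
    have hm : ((⌈H₀⌉₊ + 1 : ℕ) : ℝ) ≤ (2 : ℝ) ^ (⌈H₀⌉₊ + 1) := by exact_mod_cast hnat.le
    have hc : H₀ ≤ ((⌈H₀⌉₊ + 1 : ℕ) : ℝ) := by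
      push_cast
      linarith [Nat.le_ceil H₀]
    linarith
  have hexp : Real.exp (-(S ^ (⌈H₀⌉₊ + 1))) ≤ Real.exp (-H) := Real.exp_le_exp.mpr (by linarith)
  linarith [hsmall.trans_le hexp]

/-- Level 3 of A₄ʰ from the rank-3 residual (mod NW + KS + CF). -/
theorem sb_three_of_pieces (hNW : NesterenkoWaldschmidt1996_thm_1) (hKS : KummerSpecialisation)
    (hCF : CylinderFunnelWeak) (hR : Rank3HyperResidual) (z : Fin 3 → ℂ) (hz : LinearIndependent ℚ z)
    (hH : HyperLinLiouville z) : SB 3 z := by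
  by_cases hr : HasHLRatio z
  · exact sb_three_of_hlRatio hNW hKS hCF hz hr
  · exact hR z hz hH hr

/-- **EXACTNESS.**  Mod NW + KS + CF, the level-3 storey of A₄ʰ IS the rank-3 residual — no other cell is open. -/
theorem level3_iff_rank3 (hNW : NesterenkoWaldschmidt1996_thm_1) (hKS : KummerSpecialisation)
    (hCF : CylinderFunnelWeak) :
    (∀ z : Fin 3 → ℂ, LinearIndependent ℚ z → HyperLinLiouville z → SB 3 z) ↔ Rank3HyperResidual :=
  ⟨fun h z hz hH _ => h z hz hH, fun hR z hz hH => sb_three_of_pieces hNW hKS hCF hR z hz hH⟩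

/-- **ASSEMBLY of the live item A₄ʰ (stmt-Schanuel-33363)** from: NW96 Thm 1 (registered fact), KS, CF (typed,
attackable), the rank-3 residual (typed, barrier) and the storey `n ≥ 4` (levels `≤ 2`: round 5). -/
theorem hyperLiouvilleSchanuel_live_of_pieces (hNW : NesterenkoWaldschmidt1996_thm_1)
    (hKS : KummerSpecialisation) (hCF : CylinderFunnelWeak) (hR : Rank3HyperResidual)
    (h4 : HyperStoreyFrom4) : Summit.Schanuel.Schanuel.Theses.RootDecomp1K.HyperLiouvilleSchanuel :=
  hyperLiouvilleSchanuel_live_of_three_le hNW fun n z hn hz hH => by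
    rcases Nat.lt_or_ge n 4 with h | h
    · obtain rfl : n = 3 := by omega
      exact sb_three_of_pieces hNW hKS hCF hR z hz hH
    · exact h4 n z h hz hH


/-! ## 6. Piece CF: rungs in the tree, and sharpness in `ρ` -/

/-- A sub-pair of an algebraically independent triple is algebraically independent. -/
theorem algebraicIndependent_pair_of_triple {a b c : ℂ} (h : AlgebraicIndependent ℚ ![a, b, c]) :
    AlgebraicIndependent ℚ ![a, c] := by
  have e : ![a, c] = ![a, b, c] ∘ ![(0 : Fin 3), 2] := by
    funext i; fin_cases i <;> rfl
  rw [e]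
  exact h.comp _ fun i j hij => by fin_cases i <;> fin_cases j <;> simp_all

/-- **CF rung 1 (kernel, hypothesis-free): every RADICAL anchor.**  If `e^u` has finite transcendence type
(e.g. `u` algebraic — mod `WMeasure` —, `e^u = π`, `e^u = u` — mod NW96), then `ρ` and `e^{ρu}` are algebraically
independent for every hyper-Liouville `ρ > 0` (round 8, `algebraicIndependent_radical`). -/
theorem cylinderFunnel_at_radical {u : ℂ} (hy : FiniteTranscendenceType (cexp u)) {ρ : ℝ}
    (hρ : HyperLiouville ρ) (hρ0 : 0 < ρ) : AlgebraicIndependent ℚ ![(ρ : ℂ), cexp (u * ρ)] :=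
  algebraicIndependent_pair_of_triple (algebraicIndependent_radical rfl hy hρ hρ0)

/-- **CF rung 2 (kernel, mod NW96 Thm 1): the Kummer anchor `u = log 2`** (round 7, `algebraicIndependent_kummer`). -/
theorem cylinderFunnel_at_log_two (hNW : NesterenkoWaldschmidt1996_thm_1) {ρ : ℝ} (hρ : HyperLiouville ρ)
    (hρ0 : 0 < ρ) : AlgebraicIndependent ℚ ![(ρ : ℂ), cexp (((Real.log 2 : ℝ) : ℂ) * (ρ : ℂ))] :=
  algebraicIndependent_pair_of_triple (algebraicIndependent_kummer hNW hρ hρ0)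

/-- **CF rung 3 (kernel, hypothesis-free): the torsion anchor `u = 2πi`** (round 6, `algebraicIndependent_torsion`). -/
theorem cylinderFunnel_at_twoPiI {ρ : ℝ} (hρ : HyperLiouville ρ) :
    AlgebraicIndependent ℚ ![(ρ : ℂ), cexp (2 * Real.pi * I * ρ)] :=
  algebraicIndependent_pair_of_triple (algebraicIndependent_torsion hρ)

/-- Swapping the first two entries of an algebraically independent triple. -/
theorem algebraicIndependent_swap_of_triple {a b c : ℂ} (h : AlgebraicIndependent ℚ ![a, b, c]) :
    AlgebraicIndependent ℚ ![b, a, c] := by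
  have e : ![b, a, c] = ![a, b, c] ∘ ![(1 : Fin 3), 0, 2] := by
    funext i; fin_cases i <;> rfl
  rw [e]
  exact h.comp _ fun i j hij => by fin_cases i <;> fin_cases j <;> simp_all

/-- **Piece KS is MOOT at every radical anchor (kernel):** there its first hypothesis is contradictory
(`e^u, ρ, e^{ρu}` ARE independent, round 8) — KS is invoked only in the dark. -/
theorem kummerSpecialisation_moot_at_radical {u : ℂ} (hy : FiniteTranscendenceType (cexp u)) {ρ : ℝ}
    (hρ : HyperLiouville ρ) (hρ0 : 0 < ρ) : AlgebraicIndependent ℚ ![cexp u, (ρ : ℂ), cexp (u * ρ)] :=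
  algebraicIndependent_swap_of_triple (algebraicIndependent_radical rfl hy hρ hρ0)

/-- `log 3 / log 2` is irrational (`2^n = 3^d` is impossible for `d ≥ 1`). -/
theorem irrational_log_three_div_log_two : Irrational (Real.log 3 / Real.log 2) := by
  have hl2 : 0 < Real.log 2 := Real.log_pos (by norm_num)
  have hl3 : 0 < Real.log 3 := Real.log_pos (by norm_num)
  rintro ⟨r, hr⟩
  have hden : (0 : ℝ) < r.den := by exact_mod_cast r.den_pos
  have hr' : (r.num : ℝ) * Real.log 2 = (r.den : ℝ) * Real.log 3 := by
    have e2 : (r : ℝ) = (r.num : ℝ) / (r.den : ℝ) := Rat.cast_def r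
    rw [e2, div_eq_div_iff hden.ne' hl2.ne'] at hr
    linarith
  have hnum : 0 < r.num := by
    have h1 : (0 : ℝ) < (r.num : ℝ) * Real.log 2 := by rw [hr']; positivity
    exact_mod_cast pos_of_mul_pos_left h1 hl2.le
  -- `n log 2 = d log 3` with `n = r.num > 0`, `d = r.den > 0` ⇒ `2^n = 3^d`
  obtain ⟨n, hn⟩ : ∃ n : ℕ, (n : ℤ) = r.num := ⟨r.num.toNat, Int.toNat_of_nonneg hnum.le⟩
  have hnR : (r.num : ℝ) = n := by exact_mod_cast hn.symm
  rw [hnR] at hr'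
  have hpow : (2 : ℝ) ^ n = (3 : ℝ) ^ r.den := by
    have h2 : Real.log ((2 : ℝ) ^ n) = Real.log ((3 : ℝ) ^ r.den) := by
      rw [Real.log_pow, Real.log_pow]; exact hr'
    exact Real.log_injOn_pos (Set.mem_Ioi.mpr (by positivity)) (Set.mem_Ioi.mpr (by positivity)) h2
  have hnat : 2 ^ n = 3 ^ r.den := by exact_mod_cast hpow
  have hn0 : n ≠ 0 := by
    rintro rfl
    simp at hn; omega
  have heven : Even (2 ^ n) := (Nat.even_pow' hn0).mpr even_two
  have hodd : Odd (3 ^ r.den) := Odd.pow (by decide)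
  rw [hnat] at heven
  exact (Nat.not_even_iff_odd.mpr hodd) heven

/-- **Piece CF is SHARP in `ρ` (kernel, hypothesis-free).**  Its conclusion FAILS for the irrational, NOT
hyper-Liouville ratio `ρ = log 3 / log 2` at the anchor `u = log 2` (`e^u = 2`, `e^{ρu} = 3`): the hypothesis
`HyperLiouville ρ` of CF cannot be weakened to `Irrational ρ` — CF is a genuinely DIOPHANTINE statement. -/
theorem cylinderFunnel_sharp :
    ¬ (∀ (u : ℂ) (ρ : ℝ), u ≠ 0 → Irrational ρ → 0 < ρ →
        AlgebraicIndependent ℚ ![(ρ : ℂ), cexp u] ∨ AlgebraicIndependent ℚ ![(ρ : ℂ), cexp (u * ρ)]) := by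
  intro h
  have hl2 : 0 < Real.log 2 := Real.log_pos (by norm_num)
  have hl3 : 0 < Real.log 3 := Real.log_pos (by norm_num)
  have hu0 : ((Real.log 2 : ℝ) : ℂ) ≠ 0 := by exact_mod_cast hl2.ne'
  have hρ0 : 0 < Real.log 3 / Real.log 2 := div_pos hl3 hl2
  have hy : cexp ((Real.log 2 : ℝ) : ℂ) = 2 := by
    rw [← Complex.ofReal_exp, Real.exp_log (by norm_num)]; norm_num
  have ht : cexp (((Real.log 2 : ℝ) : ℂ) * ((Real.log 3 / Real.log 2 : ℝ) : ℂ)) = 3 := by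
    have e : ((Real.log 2 : ℝ) : ℂ) * ((Real.log 3 / Real.log 2 : ℝ) : ℂ) = ((Real.log 3 : ℝ) : ℂ) := by
      rw [← Complex.ofReal_mul, mul_div_cancel₀ _ hl2.ne']
    rw [e, ← Complex.ofReal_exp, Real.exp_log (by norm_num)]; norm_num
  have h2alg : IsAlgebraic ℚ (2 : ℂ) := by
    simpa using isAlgebraic_algebraMap (R := ℚ) (A := ℂ) (2 : ℚ)
  have h3alg : IsAlgebraic ℚ (3 : ℂ) := by
    simpa using isAlgebraic_algebraMap (R := ℚ) (A := ℂ) (3 : ℚ)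
  rcases h _ _ hu0 irrational_log_three_div_log_two hρ0 with h1 | h1
  · have := h1.transcendental 1
    simp only [Matrix.cons_val_one, Matrix.cons_val_zero, hy] at this
    exact this h2alg
  · have := h1.transcendental 1
    simp only [Matrix.cons_val_one, Matrix.cons_val_zero, ht] at this
    exact this h3alg

/-- **The generic triple is SHARP in `ρ` too (kernel, hypothesis-free):** at `u = log 2`, `ρ = log 3 / log 2`
(irrational, not hyper-Liouville) NONE of the three triples of `hyperTriple` is algebraically independent
(`trdeg ℚ(log 2, 2, ρ, 3) ≤ 2`) — a `_false_without_HyperLiouville` lemma for the whole §3–§4 package. -/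
theorem hyperTriple_sharp :
    ¬ (∀ (u : ℂ) (ρ : ℝ), u ≠ 0 → Irrational ρ → 0 < ρ →
        AlgebraicIndependent ℚ ![cexp u, (ρ : ℂ), cexp (u * ρ)] ∨
        AlgebraicIndependent ℚ (fun o : Option (Fin 2) => o.elim u ![(ρ : ℂ), cexp u]) ∨
        AlgebraicIndependent ℚ (fun o : Option (Fin 2) => o.elim u ![(ρ : ℂ), cexp (u * ρ)])) := by
  intro h
  have hl2 : 0 < Real.log 2 := Real.log_pos (by norm_num)
  have hl3 : 0 < Real.log 3 := Real.log_pos (by norm_num)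
  have hu0 : ((Real.log 2 : ℝ) : ℂ) ≠ 0 := by exact_mod_cast hl2.ne'
  have hρ0 : 0 < Real.log 3 / Real.log 2 := div_pos hl3 hl2
  have hy : cexp ((Real.log 2 : ℝ) : ℂ) = 2 := by
    rw [← Complex.ofReal_exp, Real.exp_log (by norm_num)]; norm_num
  have ht : cexp (((Real.log 2 : ℝ) : ℂ) * ((Real.log 3 / Real.log 2 : ℝ) : ℂ)) = 3 := by
    have e : ((Real.log 2 : ℝ) : ℂ) * ((Real.log 3 / Real.log 2 : ℝ) : ℂ) = ((Real.log 3 : ℝ) : ℂ) := by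
      rw [← Complex.ofReal_mul, mul_div_cancel₀ _ hl2.ne']
    rw [e, ← Complex.ofReal_exp, Real.exp_log (by norm_num)]; norm_num
  have h2alg : IsAlgebraic ℚ (2 : ℂ) := by
    simpa using isAlgebraic_algebraMap (R := ℚ) (A := ℂ) (2 : ℚ)
  have h3alg : IsAlgebraic ℚ (3 : ℂ) := by
    simpa using isAlgebraic_algebraMap (R := ℚ) (A := ℂ) (3 : ℚ)
  rcases h _ _ hu0 irrational_log_three_div_log_two hρ0 with h1 | h1 | h1
  · have := h1.transcendental 0
    simp only [Matrix.cons_val_zero, hy] at this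
    exact this h2alg
  · have := h1.transcendental (some 1)
    simp only [Option.elim, Matrix.cons_val_one, Matrix.cons_val_zero, hy] at this
    exact this h2alg
  · have := h1.transcendental (some 1)
    simp only [Option.elim, Matrix.cons_val_one, Matrix.cons_val_zero, ht] at this
    exact this h3alg

end Summit.Schanuel.Schanuel.Theorems.RootDecomp1KGeneric

end
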